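import Literature.MathematicalPhysics.QuantumFieldTheory.Balaban1983to89.B5Prop11Plancherel

/-!
# `Balaban1983to89.B5Eq129FreeResolventWeightedMass` — T. Bałaban, *Propagators and renormalization transformations for lattice gauge
# theories. I*, Commun. Math. Phys. **95** (1984) 17–40 [Balaban1984PropagatorsI] (1.29) p. 23 (free lattice operators on the finite torus), p. 36
# (exponential weights): **THE MASS OF THE FREE RESOLVENT KERNEL — `m·Σ_x k(x) = 1` EXACTLY, and against ANY `λ`-SUPERSOLUTION WEIGHT `W`
# (`λ·W ≤ (L₀ + m)W`, the binder `hsup` of `B9Eq342SupNormBootstrap.scalar_le_mul_of_supersolution`; for the product `cosh` weights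
# `λ = m − 2d·t²(cosh a − 1)` by `B5Eq129CoshSupersolution.weight_supersolution`) the WEIGHTED `ℓ¹` mass obeys `λ·Σ_x W(x)k(x) ≤ W(0)`** —
# the `ℓ¹` companion of storey (D)'s pointwise comparison `k ≤ s·W`; step (4) of the WEIGHTED ∇-row (P-J-1b) of the pub-balaban NE9 chain's
# storey J (row L13 of `t4/ROUTES-NE9.md`), whose unweighted VALUE is `B5Eq129FreeResolvent{KernelMonotone,FibreCollapse,CycleProfile,GradientRow}`

statement-level skeleton of published theorems with citation tags; proofs where landed; nothing here is a claim about the Yang–Mills mass gap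

CITATION HEADER (lean-in-tree rule).  Audit cell `pub-balaban`, sub-cell `t4`, BINDER row NE9; filed by NE9 crux-team LEAF PROVER 05
(`b2b-balaban-t4-ne9-formalise-leaf-05`, gen 80).  OBJECT: [Balaban1984PropagatorsI] (1.29) p. 23's free stencil in the encoding of the OWNER's
`B5Eq129FreeResolventSupBound` ∕ `B5Eq129CoshSupersolution` (`B5Prop11Plancherel.Tor N`, `unitVec`; the resolvent equation and the supersolution
inequality as HYPOTHESES, no `def`).  CONTENT: [folklore] — summation by parts on the torus (the flat stencil is symmetric) and one pairing.
Junction certified (dev concat, NOT filed): `hsup := fun x => B5Eq129CoshSupersolution.weight_supersolution N a t m c x` elaborates verbatim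
(cell journal [NE9LEAF05-G80-INTENT-K13]).  Nothing of [B5′] is asserted.

WHAT IS PROVED (sorry-free; proof lane — 0 `def`).
* **`sum_mul_stencil_comm`**: `Σ_x W(x)(L₀k)(x) = Σ_x k(x)(L₀W)(x)`.
* **`mul_weighted_sum_le`**: `(L₀ + m)k = δ₀`, `k ≥ 0`, `λ·W ≤ (L₀ + m)W` ⟹ `λ·Σ_x W(x)k(x) ≤ W(0)`.
* **`mul_sum_kernel_eq_one`**: `m·Σ_x k(x) = 1` (no sign hypothesis).
HONEST SCOPE.  Free (`U = 1`) scalar stencil; `k ≥ 0` is a displayed hypothesis (supplied by `B5Eq129FreeResolventKernelMonotone.nonneg_of_resolvent_nonneg`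
or `B9Eq323KatoDomination.scalar_nonneg_of_resolvent`); no weight is fixed here.  ONE step of ONE letter of ONE un-opened storey of row L13; NOT the
∇-line of (3.42), NOT Tier P, NOT NE9 (cell pub-balaban: NE9 NOT PRINTED ∕ NOT PROVED; «NE9 ⇐ the named binders»; row WALLED ON A MODEL (O-NE9-1; #5
UNRULED); spine PROVED 0∕9; rung (B)+1 finite T⁴ — NOT infinite volume, NOT mass gap, NOT BetaPertH, NOT Clay).  HONEST DEPENDENCY: continuum YM on T⁴ ⇐
BetaPertH ∧ nine spine estimates (0/9 proved); BetaPertH ⇐ (D1) ∧ (D4) ∧ CAP+tail; G-an2-4 gates asym, D1 and NE2/3/4.  NEW file importing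
`B5Prop11Plancherel` only; nothing modified.  Net new unproved facts: 0.
-/

noncomputable section

open scoped BigOperators

namespace Literature.MathematicalPhysics.QuantumFieldTheory.Balaban1983to89.B5Eq129FreeResolventWeightedMass

open B5Prop11Plancherel (Tor unitVec)

variable {d : ℕ} (N : Fin d → ℕ) [∀ μ, NeZero (N μ)]

/-- **THE FLAT STENCIL IS SYMMETRIC** (summation by parts on the torus): `Σ_x W(x)·(L₀k)(x) = Σ_x k(x)·(L₀W)(x)` for the stencil
`(L₀φ)(x) = Σ_ν t²[(φ(x) − φ(x−e_ν)) + (φ(x) − φ(x+e_ν))]` — each bond is counted once from either end. [folklore]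
[cite: Balaban1984PropagatorsI, (1.29) p.23] -/
theorem sum_mul_stencil_comm (t : ℝ) (W k : Tor N → ℝ) :
    ∑ x, W x * ∑ ν, t ^ 2 * ((k x - k (x - unitVec N ν)) + (k x - k (x + unitVec N ν))) =
      ∑ x, k x * ∑ ν, t ^ 2 * ((W x - W (x - unitVec N ν)) + (W x - W (x + unitVec N ν))) := by
  simp only [Finset.mul_sum]
  rw [Finset.sum_comm, Finset.sum_comm (f := fun x ν => k x * _)]
  refine Finset.sum_congr rfl fun ν _ => ?_
  -- per direction: `Σ_x W x (k x − k(x−e)) + W x (k x − k(x+e)) = Σ_x k x (W x − W(x−e)) + k x (W x − W(x+e))`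
  have h1 : ∑ x : Tor N, W x * k (x - unitVec N ν) = ∑ x : Tor N, W (x + unitVec N ν) * k x :=
    Fintype.sum_equiv (Equiv.subRight (unitVec N ν)) _ _ fun x => by
      simp only [Equiv.subRight_apply, sub_add_cancel]
  have h2 : ∑ x : Tor N, W x * k (x + unitVec N ν) = ∑ x : Tor N, W (x - unitVec N ν) * k x :=
    Fintype.sum_equiv (Equiv.addRight (unitVec N ν)) _ _ fun x => by
      simp only [Equiv.coe_addRight, add_sub_cancel_right]
  have e1 : ∀ x : Tor N, W x * (t ^ 2 * ((k x - k (x - unitVec N ν)) + (k x - k (x + unitVec N ν)))) =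
      t ^ 2 * (2 * (W x * k x) - W x * k (x - unitVec N ν) - W x * k (x + unitVec N ν)) := fun x => by ring
  have e2 : ∀ x : Tor N, k x * (t ^ 2 * ((W x - W (x - unitVec N ν)) + (W x - W (x + unitVec N ν)))) =
      t ^ 2 * (2 * (W x * k x) - W (x - unitVec N ν) * k x - W (x + unitVec N ν) * k x) := fun x => by ring
  simp only [e1, e2, ← Finset.mul_sum, Finset.sum_sub_distrib, h1, h2]
  ring

/-- **WEIGHTED MASS OF THE RESOLVENT KERNEL AGAINST A SUPERSOLUTION WEIGHT.**  Let `k ≥ 0` solve `(L₀ + m)k = δ₀` on `Π_μ ℤ∕N_μ` and let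
the weight `W` be a `λ`-supersolution, `λ·W ≤ (L₀ + m)W` pointwise — VERBATIM the binder `hsup` of
`B9Eq342SupNormBootstrap.scalar_le_mul_of_supersolution`, inhabited for the product `cosh` weights by
`B5Eq129CoshSupersolution.weight_supersolution` with `λ = m − 2d·t²(cosh a − 1)`.  Then `λ·Σ_x W(x)k(x) ≤ W(0)`: the exponentially WEIGHTED
`ℓ¹` MASS of the kernel is height-free (`≤ W(0)∕λ` for `λ > 0`) — an `ℓ¹` companion of the pointwise comparison `k ≤ s·W`.  Proof: pair the
equation with `W`, move the stencil onto `W` (`sum_mul_stencil_comm`), use `k ≥ 0`. [folklore] [cite: Balaban1984PropagatorsI, (1.29) p.23] -/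
theorem mul_weighted_sum_le (t m lam : ℝ) {k W : Tor N → ℝ}
    (hk : ∀ x, ∑ ν, t ^ 2 * ((k x - k (x - unitVec N ν)) + (k x - k (x + unitVec N ν))) + m * k x = if x = 0 then 1 else 0)
    (hk0 : ∀ x, 0 ≤ k x)
    (hsup : ∀ x, lam * W x ≤ ∑ ν, t ^ 2 * ((W x - W (x - unitVec N ν)) + (W x - W (x + unitVec N ν))) + m * W x) :
    lam * ∑ x, W x * k x ≤ W 0 := by
  classical
  -- pair the equation with `W`
  have hpair : ∑ x, W x * (∑ ν, t ^ 2 * ((k x - k (x - unitVec N ν)) + (k x - k (x + unitVec N ν))) + m * k x) = W 0 := by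
    rw [Finset.sum_congr rfl fun x _ => by rw [hk x]]
    simp [Finset.sum_ite_eq']
  have hsplit : ∑ x, W x * (∑ ν, t ^ 2 * ((k x - k (x - unitVec N ν)) + (k x - k (x + unitVec N ν))) + m * k x) =
      ∑ x, k x * (∑ ν, t ^ 2 * ((W x - W (x - unitVec N ν)) + (W x - W (x + unitVec N ν))) + m * W x) := by
    rw [Finset.sum_congr rfl fun x _ => (mul_add _ _ _), Finset.sum_add_distrib, sum_mul_stencil_comm N t W k,
      ← Finset.sum_add_distrib]
    exact Finset.sum_congr rfl fun x _ => by ring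
  -- the supersolution bound, weighted by `k ≥ 0`
  have hdef : lam * ∑ x, W x * k x ≤
      ∑ x, k x * (∑ ν, t ^ 2 * ((W x - W (x - unitVec N ν)) + (W x - W (x + unitVec N ν))) + m * W x) := by
    rw [Finset.mul_sum]
    refine Finset.sum_le_sum fun x _ => ?_
    have := mul_le_mul_of_nonneg_left (hsup x) (hk0 x)
    linarith [this]
  rw [hsplit] at hpair
  linarith [hpair, hdef]

/-- **THE UNWEIGHTED MASS IS EXACT**: `m·Σ_x k(x) = 1` for every solution of `(L₀ + m)k = δ₀` (no sign hypothesis; the stencil sums to zero).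
[folklore] [cite: Balaban1984PropagatorsI, (1.29) p.23] -/
theorem mul_sum_kernel_eq_one (t m : ℝ) {k : Tor N → ℝ}
    (hk : ∀ x, ∑ ν, t ^ 2 * ((k x - k (x - unitVec N ν)) + (k x - k (x + unitVec N ν))) + m * k x = if x = 0 then 1 else 0) :
    m * ∑ x, k x = 1 := by
  classical
  have hpair : ∑ x, (1 : ℝ) * (∑ ν, t ^ 2 * ((k x - k (x - unitVec N ν)) + (k x - k (x + unitVec N ν))) + m * k x) = 1 := by
    rw [Finset.sum_congr rfl fun x _ => by rw [hk x]]
    simp [Finset.sum_ite_eq']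
  have h0 : ∑ x, k x * ∑ ν, t ^ 2 * (((fun _ => (1 : ℝ)) x - (fun _ => (1 : ℝ)) (x - unitVec N ν)) +
      ((fun _ => (1 : ℝ)) x - (fun _ => (1 : ℝ)) (x + unitVec N ν))) = 0 := by simp
  rw [← hpair, Finset.sum_congr rfl fun x _ => (mul_add _ _ _), Finset.sum_add_distrib,
    sum_mul_stencil_comm N t (fun _ => (1 : ℝ)) k, h0, zero_add, Finset.mul_sum]
  exact Finset.sum_congr rfl fun x _ => by ring

end Literature.MathematicalPhysics.QuantumFieldTheory.Balaban1983to89.B5Eq129FreeResolventWeightedMass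

end
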